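import Summits.QuantumFields.YangMills.Theorems.BalabanLadderNTStrongCouplingClosedFamilies
import HarnessLib

/-!
# Crux `NT` (stmt-QuantumFields-19353), strong-coupling rung: the TUBE CLASSIFICATION — closed families of at most ten
# plaquettes of `ℤ⁴` through a plaquette at time `c` and a plaquette at time `c - 2` are the ten-face tubes

Helper file of the fleet lead prover of crux `NT` (unit `ym-spine-19353-p1`, g18).  HAND PROOF (no kernel search) of
the combinatorial input of the rung conjunct `MirrorFloorSU2` (`Cruxes/NT/Lines/strong_coupling_rung.lean`):

* `eq_tube_of_closed` — a CLOSED family `F` (no private bond) of at most ten plaquettes of `ℤ⁴` containing a plaquette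
  `(x; a)` and some plaquette based at time `x 0 - 2` is the boundary of the `2 × 1 × 1` box
  `[x 0 - 2, x 0] × (the unit square of (x; a))`: `a` is not temporal and
  `F = {(x; a), (x - 2e₀; a)} ∪ {the four temporal sides over the square at times x 0 - 1 and x 0 - 2}`.

Proof (slabs of the tree's Osterwalder–Seiler geometry, `Literature…StrongCouplingClustering` §Slab, and the toolkit
`…ClosedFamilies`): if no temporal member were based at time `x 0 - 1` (resp. `x 0 - 2`) the family would split into two
closed non-empty parts, each of at least six members (`twelve_le_card_of_gap`); so both slabs are occupied, hence carry at
least four temporal members each (`four_le_card_slab_of_closed`), and a third occupied slab would cost twelve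
(`twelve_le_card_of_three_slabs`) — so the slabs at times `x 0` and `x 0 - 3` are empty and `(x; a)` is not temporal.  The
far bond (at time `x 0`) of a temporal member of the upper slab lies in a non-temporal member at time `x 0`, the near bond
(at time `x 0 - 2`) of a temporal member of the lower slab in a non-temporal member at time `x 0 - 2`
(`cases_of_transverse_mem`); counting `4 + 4 + 1 + 1 ≤ 10` the family is exactly: the two slabs (four members each),
`(x; a)`, and ONE non-temporal member `q` at time `x 0 - 2`.  Then the upper slab consists of the four sides over the square
of `(x; a)` (their far bonds are bonds of `(x; a)`), the lower slab of their translates (far bonds again), and `q` contains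
two parallel near bonds of the lower sides, so `q = (x - 2e₀; a)` (`eq_of_two_ilinks`).

HONEST FRAMING: lattice combinatorics only; nothing about measures, `β`, NT or the gap.
-/

namespace Summit.QuantumFields.YangMills.Cruxes.NT.StrongCouplingRung.ClosedFamilies

open Finset
open Literature.Probability.LatticeModels (Site)
open Literature.MathematicalPhysics.QuantumLattice (ZdEdge ZdPlaquette plaquetteEdges)
open Literature.MathematicalPhysics.QuantumFieldTheory (IsParallel mk_mem_plaquetteEdges_iff eq_of_two_ilinks
  add_single_ne_self)

/-! ### Bond covering across a slab -/

/-- **Far covering.** In a closed family, the far transverse bond `(y + e₀, m)` of a temporal member `(y; 0, m)` lies in a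
non-temporal member based at time `y 0 + 1` or in the temporal member `(y + e₀; 0, m)`. [folklore] -/
theorem far_cases {F : Finset (ZdPlaquette 4)}
    (hN : ∀ p ∈ F, ∀ ℓ ∈ plaquetteEdges p, ∃ p' ∈ F, p' ≠ p ∧ ℓ ∈ plaquetteEdges p')
    {y : Site 4} {m : Fin 4} {hm : (0 : Fin 4) < m} (hp : ((y, ⟨(0, m), hm⟩) : ZdPlaquette 4) ∈ F) :
    (∃ q ∈ F, ¬ IsParallel q 0 ∧ q.1 0 = y 0 + 1 ∧ ((y + Pi.single 0 1, m) : ZdEdge 4) ∈ plaquetteEdges q) ∨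
      ((y + Pi.single 0 1, ⟨(0, m), hm⟩) : ZdPlaquette 4) ∈ F := by
  have hfar : ((y + Pi.single 0 1, m) : ZdEdge 4) ∈ plaquetteEdges ((y, ⟨(0, m), hm⟩) : ZdPlaquette 4) := by
    rw [mk_mem_plaquetteEdges_iff]
    exact Or.inr ⟨rfl, Or.inl rfl⟩
  obtain ⟨q, hq, hne, hmem⟩ := hN _ hp _ hfar
  obtain ⟨x', ⟨⟨j, k⟩, hjk⟩⟩ := q
  rcases cases_of_transverse_mem hm hmem with ⟨h0, hj⟩ | ⟨hj, hk, hx'⟩ | ⟨hj, hk, hx'⟩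
  · refine Or.inl ⟨_, hq, ?_, ?_, hmem⟩
    · rw [isParallel_zero_iff]
      exact hj
    · show x' 0 = y 0 + 1
      rw [h0]
      simp
  · subst hj hk hx'
    exact Or.inr hq
  · subst hj hk hx'
    exact absurd (by simp) hne

/-- **Near covering.** In a closed family, the near transverse bond `(y, m)` of a temporal member `(y; 0, m)` lies in a
non-temporal member based at time `y 0` or in the temporal member `(y - e₀; 0, m)`. [folklore] -/
theorem near_cases {F : Finset (ZdPlaquette 4)}
    (hN : ∀ p ∈ F, ∀ ℓ ∈ plaquetteEdges p, ∃ p' ∈ F, p' ≠ p ∧ ℓ ∈ plaquetteEdges p')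
    {y : Site 4} {m : Fin 4} {hm : (0 : Fin 4) < m} (hp : ((y, ⟨(0, m), hm⟩) : ZdPlaquette 4) ∈ F) :
    (∃ q ∈ F, ¬ IsParallel q 0 ∧ q.1 0 = y 0 ∧ ((y, m) : ZdEdge 4) ∈ plaquetteEdges q) ∨
      ((y - Pi.single 0 1, ⟨(0, m), hm⟩) : ZdPlaquette 4) ∈ F := by
  have hnear : ((y, m) : ZdEdge 4) ∈ plaquetteEdges ((y, ⟨(0, m), hm⟩) : ZdPlaquette 4) := by
    rw [mk_mem_plaquetteEdges_iff]
    exact Or.inr ⟨rfl, Or.inr rfl⟩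
  obtain ⟨q, hq, hne, hmem⟩ := hN _ hp _ hnear
  obtain ⟨x', ⟨⟨j, k⟩, hjk⟩⟩ := q
  rcases cases_of_transverse_mem hm hmem with ⟨h0, hj⟩ | ⟨hj, hk, hx'⟩ | ⟨hj, hk, hx'⟩
  · refine Or.inl ⟨_, hq, ?_, h0, hmem⟩
    rw [isParallel_zero_iff]
    exact hj
  · subst hj hk hx'
    exact absurd rfl hne
  · subst hj hk hx'
    exact Or.inr hq

/-- Shifting a membership in a four-element list of plaquettes by `-v` in the base point. [folklore] -/
theorem mem_four_of_add_mem {y z₁ z₂ z₃ z₄ : Site 4} (v : Site 4) {o o₁ o₂ o₃ o₄ : {q : Fin 4 × Fin 4 // q.1 < q.2}}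
    (h : ((y + v, o) : ZdPlaquette 4) ∈ ({(z₁, o₁), (z₂, o₂), (z₃, o₃), (z₄, o₄)} : Finset (ZdPlaquette 4))) :
    ((y, o) : ZdPlaquette 4) ∈ ({(z₁ - v, o₁), (z₂ - v, o₂), (z₃ - v, o₃), (z₄ - v, o₄)} : Finset (ZdPlaquette 4)) := by
  simp only [mem_insert, mem_singleton, Prod.mk.injEq] at h ⊢
  rcases h with ⟨h, h'⟩ | ⟨h, h'⟩ | ⟨h, h'⟩ | ⟨h, h'⟩
  · exact Or.inl ⟨eq_sub_of_add_eq h, h'⟩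
  · exact Or.inr (Or.inl ⟨eq_sub_of_add_eq h, h'⟩)
  · exact Or.inr (Or.inr (Or.inl ⟨eq_sub_of_add_eq h, h'⟩))
  · exact Or.inr (Or.inr (Or.inr ⟨eq_sub_of_add_eq h, h'⟩))

/-- **The far bonds of the sides are the bonds of the cap.** If the far bond `(y + e₀, m)` of the temporal plaquette
`(y; 0, m)` is a bond of the non-temporal plaquette `(x; a₁, a₂)`, then `(y; 0, m)` is one of the four temporal sides
`(x - e₀; 0, a₁)`, `(x - e₀ + e_{a₂}; 0, a₁)`, `(x - e₀; 0, a₂)`, `(x - e₀ + e_{a₁}; 0, a₂)` under the square of `(x; a₁, a₂)`.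
[folklore] -/
theorem mem_sides_of_far_mem {x y : Site 4} {a₁ a₂ m : Fin 4} {h₁₂ : a₁ < a₂} (ha : (0 : Fin 4) < a₁)
    {hm : (0 : Fin 4) < m}
    (h : ((y + Pi.single 0 1, m) : ZdEdge 4) ∈ plaquetteEdges ((x, ⟨(a₁, a₂), h₁₂⟩) : ZdPlaquette 4)) :
    ((y, ⟨(0, m), hm⟩) : ZdPlaquette 4) ∈
      ({(x - Pi.single 0 1, ⟨(0, a₁), ha⟩), (x - Pi.single 0 1 + Pi.single a₂ 1, ⟨(0, a₁), ha⟩),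
        (x - Pi.single 0 1, ⟨(0, a₂), ha.trans h₁₂⟩),
        (x - Pi.single 0 1 + Pi.single a₁ 1, ⟨(0, a₂), ha.trans h₁₂⟩)} : Finset (ZdPlaquette 4)) := by
  rw [mk_mem_plaquetteEdges_iff] at h
  simp only at h
  simp only [mem_insert, mem_singleton, Prod.mk.injEq, Subtype.mk.injEq, true_and]
  rcases h with ⟨hm', h | h⟩ | ⟨hm', h | h⟩
  · exact Or.inl ⟨eq_sub_of_add_eq h, hm'.symm⟩
  · exact Or.inr (Or.inl ⟨(eq_sub_of_add_eq h).trans (add_sub_right_comm _ _ _), hm'.symm⟩)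
  · exact Or.inr (Or.inr (Or.inr ⟨(eq_sub_of_add_eq h).trans (add_sub_right_comm _ _ _), hm'.symm⟩))
  · exact Or.inr (Or.inr (Or.inl ⟨eq_sub_of_add_eq h, hm'.symm⟩))

/-! ### The classification -/

/-- **Tube classification.** A closed family `F` of at most ten plaquettes of `ℤ⁴` containing a plaquette `(x; a)` and
some plaquette based at time `x 0 - 2` is the ten-face boundary of the `2 × 1 × 1` box under the square of `(x; a)`: the
plaquette `(x; a)` is not temporal (`0 < a₁`), and `F` consists of the eight temporal sides under the square of `(x; a)` at
times `x 0 - 1` and `x 0 - 2` and the two caps `(x; a)`, `(x - 2e₀; a)`. [folklore] -/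
theorem eq_tube_of_closed {F : Finset (ZdPlaquette 4)}
    (hN : ∀ p ∈ F, ∀ ℓ ∈ plaquetteEdges p, ∃ p' ∈ F, p' ≠ p ∧ ℓ ∈ plaquetteEdges p')
    (h10 : F.card ≤ 10) {x : Site 4} {a : {q : Fin 4 × Fin 4 // q.1 < q.2}} (hx : ((x, a) : ZdPlaquette 4) ∈ F)
    (hlow : ∃ p ∈ F, p.1 0 = x 0 - 2) :
    ∃ ha : (0 : Fin 4) < a.1.1, F =
      {(x - Pi.single 0 1, ⟨(0, a.1.1), ha⟩), (x - Pi.single 0 1 + Pi.single a.1.2 1, ⟨(0, a.1.1), ha⟩),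
        (x - Pi.single 0 1, ⟨(0, a.1.2), ha.trans a.2⟩),
        (x - Pi.single 0 1 + Pi.single a.1.1 1, ⟨(0, a.1.2), ha.trans a.2⟩),
        (x - Pi.single 0 1 - Pi.single 0 1, ⟨(0, a.1.1), ha⟩),
        (x - Pi.single 0 1 + Pi.single a.1.2 1 - Pi.single 0 1, ⟨(0, a.1.1), ha⟩),
        (x - Pi.single 0 1 - Pi.single 0 1, ⟨(0, a.1.2), ha.trans a.2⟩),
        (x - Pi.single 0 1 + Pi.single a.1.1 1 - Pi.single 0 1, ⟨(0, a.1.2), ha.trans a.2⟩),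
        (x, a), (x - Pi.single 0 1 - Pi.single 0 1, a)} := by
  obtain ⟨⟨a₁, a₂⟩, h₁₂⟩ := a
  obtain ⟨pl, hpl, hplc⟩ := hlow
  -- Step 1: the slabs at times `x 0 - 1` and `x 0 - 2` are occupied (else the family splits into two closed parts)
  have hex1 : ∃ p ∈ F, IsParallel p 0 ∧ p.1 0 = x 0 - 1 := by
    by_contra h
    push Not at h
    have := twelve_le_card_of_gap hN 0 (x 0 - 1) h ⟨pl, hpl, by omega⟩ ⟨_, hx, by show _ ≤ x 0; omega⟩
    omega
  have hex2 : ∃ p ∈ F, IsParallel p 0 ∧ p.1 0 = x 0 - 2 := by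
    by_contra h
    push Not at h
    have := twelve_le_card_of_gap hN 0 (x 0 - 2) h ⟨pl, hpl, by omega⟩ ⟨_, hx, by show _ ≤ x 0; omega⟩
    omega
  have h4a := four_le_card_slab_of_closed hN 0 (x 0 - 1) hex1
  have h4b := four_le_card_slab_of_closed hN 0 (x 0 - 2) hex2
  -- Step 2: the slabs at times `x 0` and `x 0 - 3` are empty (a third occupied slab costs twelve members)
  have hT0 : ∀ p ∈ F, IsParallel p 0 → p.1 0 ≠ x 0 := by
    intro p hp hpar hpc
    have := twelve_le_card_of_three_slabs hN 0 (t₁ := x 0 - 1) (t₂ := x 0 - 2) (t₃ := x 0) (by omega) (by omega)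
      (by omega) hex1 hex2 ⟨p, hp, hpar, hpc⟩
    omega
  have hT3 : ∀ p ∈ F, IsParallel p 0 → p.1 0 ≠ x 0 - 3 := by
    intro p hp hpar hpc
    have := twelve_le_card_of_three_slabs hN 0 (t₁ := x 0 - 1) (t₂ := x 0 - 2) (t₃ := x 0 - 3) (by omega) (by omega)
      (by omega) hex1 hex2 ⟨p, hp, hpar, hpc⟩
    omega
  -- Step 3: the cap `(x; a)` is not temporal
  have hxa : ¬ IsParallel ((x, ⟨(a₁, a₂), h₁₂⟩) : ZdPlaquette 4) 0 := fun h => hT0 _ hx h rfl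
  have ha : (0 : Fin 4) < a₁ := by
    rw [isParallel_zero_iff] at hxa
    exact Fin.pos_of_ne_zero hxa
  refine ⟨ha, ?_⟩
  -- Step 4: the four pieces and the count `4 + 4 + 1 + 1 ≤ 10`
  set T1 := F.filter (fun p => IsParallel p 0 ∧ p.1 0 = x 0 - 1) with hT1
  set T2 := F.filter (fun p => IsParallel p 0 ∧ p.1 0 = x 0 - 2) with hT2
  set S0 := F.filter (fun p => ¬ IsParallel p 0 ∧ p.1 0 = x 0) with hS0
  set S2 := F.filter (fun p => ¬ IsParallel p 0 ∧ p.1 0 = x 0 - 2) with hS2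
  have hxS0 : ((x, ⟨(a₁, a₂), h₁₂⟩) : ZdPlaquette 4) ∈ S0 := mem_filter.2 ⟨hx, hxa, rfl⟩
  have hS2ne : S2.Nonempty := by
    obtain ⟨p, hp, hpar, hpc⟩ := hex2
    obtain ⟨y, ⟨⟨j, m⟩, hjm⟩⟩ := p
    rw [isParallel_zero_iff] at hpar
    simp only at hpar hpc
    subst hpar
    rcases near_cases hN hp with ⟨q, hq, hqpar, hq0, -⟩ | hq
    · exact ⟨q, mem_filter.2 ⟨hq, hqpar, by rw [hq0, hpc]⟩⟩
    · refine absurd ?_ (hT3 _ hq (Or.inl rfl))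
      show (y - Pi.single 0 1 : Site 4) 0 = x 0 - 3
      simp [hpc]
      ring
  have hU : T1 ∪ T2 ∪ S0 ∪ S2 ⊆ F :=
    union_subset (union_subset (union_subset (filter_subset _ _) (filter_subset _ _)) (filter_subset _ _))
      (filter_subset _ _)
  have hcardU : (T1 ∪ T2 ∪ S0 ∪ S2).card = T1.card + T2.card + S0.card + S2.card := by
    rw [card_union_of_disjoint, card_union_of_disjoint, card_union_of_disjoint]
    · exact disjoint_filter.2 fun p _ h1 h2 => by omega
    · rw [disjoint_union_left]
      exact ⟨disjoint_filter.2 fun p _ h1 h2 => h2.1 h1.1, disjoint_filter.2 fun p _ h1 h2 => h2.1 h1.1⟩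
    · rw [disjoint_union_left, disjoint_union_left]
      exact ⟨⟨disjoint_filter.2 fun p _ h1 h2 => h2.1 h1.1, disjoint_filter.2 fun p _ h1 h2 => h2.1 h1.1⟩,
        disjoint_filter.2 fun p _ h1 h2 => by omega⟩
  have hS0pos : 0 < S0.card := card_pos.2 ⟨_, hxS0⟩
  have hS2pos : 0 < S2.card := card_pos.2 hS2ne
  have hFU : T1 ∪ T2 ∪ S0 ∪ S2 = F := eq_of_subset_of_card_le hU (by rw [hcardU]; omega)
  have hcards : T1.card = 4 ∧ T2.card = 4 ∧ S0.card = 1 ∧ S2.card = 1 := by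
    have := card_le_card hU
    rw [hcardU] at this
    omega
  -- Step 5: `S0 = {(x; a)}`, `S2 = {q}`, no non-temporal member at time `x 0 - 1`
  have hS0eq : S0 = {((x, ⟨(a₁, a₂), h₁₂⟩) : ZdPlaquette 4)} := by
    obtain ⟨z, hz⟩ := card_eq_one.1 hcards.2.2.1
    rw [hz] at hxS0 ⊢
    rw [mem_singleton.1 hxS0]
  obtain ⟨qb, hS2eq⟩ := card_eq_one.1 hcards.2.2.2
  have hqb : qb ∈ S2 := by
    rw [hS2eq]
    exact mem_singleton_self _
  have hmemF : ∀ q ∈ F, q ∈ T1 ∨ q ∈ T2 ∨ q ∈ S0 ∨ q ∈ S2 := by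
    intro q hq
    rw [← hFU] at hq
    simpa only [mem_union, or_assoc] using hq
  have hS1 : ∀ q ∈ F, ¬ IsParallel q 0 → q.1 0 ≠ x 0 - 1 := by
    intro q hq hpar hlev
    rcases hmemF q hq with h | h | h | h
    · exact hpar (mem_filter.1 h).2.1
    · have := (mem_filter.1 h).2.2
      omega
    · have := (mem_filter.1 h).2.2
      omega
    · have := (mem_filter.1 h).2.2
      omega
  -- Step 6: the upper slab consists of the four sides under the square of `(x; a)` (far bonds)
  have hT1eq : T1 = {(x - Pi.single 0 1, ⟨(0, a₁), ha⟩), (x - Pi.single 0 1 + Pi.single a₂ 1, ⟨(0, a₁), ha⟩),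
      (x - Pi.single 0 1, ⟨(0, a₂), ha.trans h₁₂⟩),
      (x - Pi.single 0 1 + Pi.single a₁ 1, ⟨(0, a₂), ha.trans h₁₂⟩)} := by
    refine eq_of_subset_of_card_le (fun p hp => ?_) (by rw [hcards.1]; exact card_le_four)
    obtain ⟨hpF, hpar, hpc⟩ := mem_filter.1 hp
    obtain ⟨y, ⟨⟨j, m⟩, hjm⟩⟩ := p
    rw [isParallel_zero_iff] at hpar
    simp only at hpar hpc
    subst hpar
    rcases far_cases hN hpF with ⟨q, hq, hqpar, hq0, hmem⟩ | hq
    · have hqS0 : q ∈ S0 := mem_filter.2 ⟨hq, hqpar, by rw [hq0, hpc]; ring⟩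
      rw [hS0eq, mem_singleton] at hqS0
      subst hqS0
      exact mem_sides_of_far_mem ha hmem
    · refine absurd ?_ (hT0 _ hq (Or.inl rfl))
      show (y + Pi.single 0 1 : Site 4) 0 = x 0
      simp [hpc]
  -- Step 7: the lower slab consists of their translates by `-e₀` (far bonds again)
  have hT2eq : T2 = {(x - Pi.single 0 1 - Pi.single 0 1, ⟨(0, a₁), ha⟩),
      (x - Pi.single 0 1 + Pi.single a₂ 1 - Pi.single 0 1, ⟨(0, a₁), ha⟩),
      (x - Pi.single 0 1 - Pi.single 0 1, ⟨(0, a₂), ha.trans h₁₂⟩),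
      (x - Pi.single 0 1 + Pi.single a₁ 1 - Pi.single 0 1, ⟨(0, a₂), ha.trans h₁₂⟩)} := by
    refine eq_of_subset_of_card_le (fun p hp => ?_) (by rw [hcards.2.1]; exact card_le_four)
    obtain ⟨hpF, hpar, hpc⟩ := mem_filter.1 hp
    obtain ⟨y, ⟨⟨j, m⟩, hjm⟩⟩ := p
    rw [isParallel_zero_iff] at hpar
    simp only at hpar hpc
    subst hpar
    rcases far_cases hN hpF with ⟨q, hq, hqpar, hq0, -⟩ | hq
    · refine absurd ?_ (hS1 q hq hqpar)
      rw [hq0, hpc]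
      ring
    · have hqT1 : ((y + Pi.single 0 1, ⟨(0, m), hjm⟩) : ZdPlaquette 4) ∈ T1 :=
        mem_filter.2 ⟨hq, Or.inl rfl, by show (y + Pi.single 0 1 : Site 4) 0 = x 0 - 1; simp [hpc]; ring⟩
      rw [hT1eq] at hqT1
      exact mem_four_of_add_mem _ hqT1
  -- Step 8: the bottom cap: `qb` contains two parallel near bonds of the lower sides
  have hqbF : qb ∈ F := (mem_filter.1 hqb).1
  have hnear : ∀ (z : Site 4), ((z, ⟨(0, a₁), ha⟩) : ZdPlaquette 4) ∈ T2 →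
      ((z, a₁) : ZdEdge 4) ∈ plaquetteEdges qb := by
    intro z hz
    obtain ⟨hzF, -, hzc⟩ := mem_filter.1 hz
    simp only at hzc
    rcases near_cases hN hzF with ⟨q, hq, hqpar, hq0, hmem⟩ | hq
    · have hqS2 : q ∈ S2 := mem_filter.2 ⟨hq, hqpar, by rw [hq0, hzc]⟩
      rw [hS2eq, mem_singleton] at hqS2
      rw [← hqS2]
      exact hmem
    · refine absurd ?_ (hT3 _ hq (Or.inl rfl))
      show (z - Pi.single 0 1 : Site 4) 0 = x 0 - 3
      simp [hzc]
      ring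
  have hz₁ : ((x - Pi.single 0 1 - Pi.single 0 1, ⟨(0, a₁), ha⟩) : ZdPlaquette 4) ∈ T2 := by
    rw [hT2eq]
    simp
  have hz₂ : ((x - Pi.single 0 1 + Pi.single a₂ 1 - Pi.single 0 1, ⟨(0, a₁), ha⟩) : ZdPlaquette 4) ∈ T2 := by
    rw [hT2eq]
    simp
  have hb₁ : ((x - Pi.single 0 1 - Pi.single 0 1, a₁) : ZdEdge 4) ∈
      plaquetteEdges ((x - Pi.single 0 1 - Pi.single 0 1, ⟨(a₁, a₂), h₁₂⟩) : ZdPlaquette 4) := by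
    rw [mk_mem_plaquetteEdges_iff]
    exact Or.inl ⟨rfl, Or.inl rfl⟩
  have hb₂ : ((x - Pi.single 0 1 + Pi.single a₂ 1 - Pi.single 0 1, a₁) : ZdEdge 4) ∈
      plaquetteEdges ((x - Pi.single 0 1 - Pi.single 0 1, ⟨(a₁, a₂), h₁₂⟩) : ZdPlaquette 4) := by
    rw [mk_mem_plaquetteEdges_iff]
    exact Or.inl ⟨rfl, Or.inr (add_sub_right_comm _ _ _)⟩
  have hneq : (x - Pi.single 0 1 - Pi.single 0 1 : Site 4) ≠ x - Pi.single 0 1 + Pi.single a₂ 1 - Pi.single 0 1 := by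
    rw [add_sub_right_comm]
    exact (add_single_ne_self _ _).symm
  have hcap : ((x - Pi.single 0 1 - Pi.single 0 1, ⟨(a₁, a₂), h₁₂⟩) : ZdPlaquette 4) = qb :=
    eq_of_two_ilinks hneq hb₁ hb₂ (hnear _ hz₁) (hnear _ hz₂)
  -- Step 9: assemble
  rw [← hFU, hT1eq, hT2eq, hS0eq, hS2eq, ← hcap]
  simp only [insert_union, ← insert_eq]

/-! ### The three tubes through the time-mirror pair `e₀, -e₀` -/

/-- `0 < 1` in `Fin 4`. -/
private theorem lt01 : ((0 : Fin 4), (1 : Fin 4)).1 < ((0 : Fin 4), (1 : Fin 4)).2 := by decide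
/-- `0 < 2` in `Fin 4`. -/
private theorem lt02 : ((0 : Fin 4), (2 : Fin 4)).1 < ((0 : Fin 4), (2 : Fin 4)).2 := by decide
/-- `0 < 3` in `Fin 4`. -/
private theorem lt03 : ((0 : Fin 4), (3 : Fin 4)).1 < ((0 : Fin 4), (3 : Fin 4)).2 := by decide
/-- `1 < 2` in `Fin 4`. -/
private theorem lt12 : ((1 : Fin 4), (2 : Fin 4)).1 < ((1 : Fin 4), (2 : Fin 4)).2 := by decide
/-- `1 < 3` in `Fin 4`. -/
private theorem lt13 : ((1 : Fin 4), (3 : Fin 4)).1 < ((1 : Fin 4), (3 : Fin 4)).2 := by decide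
/-- `2 < 3` in `Fin 4`. -/
private theorem lt23 : ((2 : Fin 4), (3 : Fin 4)).1 < ((2 : Fin 4), (3 : Fin 4)).2 := by decide

/-- Kernel bookkeeping: for each non-temporal orientation `a` the tube under the square of `(e₀; a)` computed by
`eq_tube_of_closed` is, literally, one of the three tubes `T₁₂, T₁₃, T₂₃` of `…MirrorTubes`. [folklore] -/
private theorem tube_mem_tubes : ∀ (a : {q : Fin 4 × Fin 4 // q.1 < q.2}) (ha : (0 : Fin 4) < a.1.1),
    ({((![1, 0, 0, 0] : Fin 4 → ℤ) - Pi.single 0 1, ⟨(0, a.1.1), ha⟩),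
        ((![1, 0, 0, 0] : Fin 4 → ℤ) - Pi.single 0 1 + Pi.single a.1.2 1, ⟨(0, a.1.1), ha⟩),
        ((![1, 0, 0, 0] : Fin 4 → ℤ) - Pi.single 0 1, ⟨(0, a.1.2), ha.trans a.2⟩),
        ((![1, 0, 0, 0] : Fin 4 → ℤ) - Pi.single 0 1 + Pi.single a.1.1 1, ⟨(0, a.1.2), ha.trans a.2⟩),
        ((![1, 0, 0, 0] : Fin 4 → ℤ) - Pi.single 0 1 - Pi.single 0 1, ⟨(0, a.1.1), ha⟩),
        ((![1, 0, 0, 0] : Fin 4 → ℤ) - Pi.single 0 1 + Pi.single a.1.2 1 - Pi.single 0 1, ⟨(0, a.1.1), ha⟩),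
        ((![1, 0, 0, 0] : Fin 4 → ℤ) - Pi.single 0 1 - Pi.single 0 1, ⟨(0, a.1.2), ha.trans a.2⟩),
        ((![1, 0, 0, 0] : Fin 4 → ℤ) - Pi.single 0 1 + Pi.single a.1.1 1 - Pi.single 0 1, ⟨(0, a.1.2), ha.trans a.2⟩),
        ((![1, 0, 0, 0] : Fin 4 → ℤ), a), ((![1, 0, 0, 0] : Fin 4 → ℤ) - Pi.single 0 1 - Pi.single 0 1, a)} :
        Finset (ZdPlaquette 4)) ∈
      ({({(![-1,0,0,0], ⟨(0, 1), lt01⟩), (![0,0,0,0], ⟨(0, 1), lt01⟩), (![-1,0,0,0], ⟨(1, 2), lt12⟩), (![1,0,0,0], ⟨(1, 2), lt12⟩), (![-1,0,1,0], ⟨(0, 1), lt01⟩), (![-1,0,0,0], ⟨(0, 2), lt02⟩), (![-1,1,0,0], ⟨(0, 2), lt02⟩), (![0,0,1,0], ⟨(0, 1), lt01⟩), (![0,0,0,0], ⟨(0, 2), lt02⟩), (![0,1,0,0], ⟨(0, 2), lt02⟩)} : Finset (ZdPlaquette 4)),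
        ({(![-1,0,0,0], ⟨(0, 1), lt01⟩), (![0,0,0,0], ⟨(0, 1), lt01⟩), (![-1,0,0,0], ⟨(1, 3), lt13⟩), (![1,0,0,0], ⟨(1, 3), lt13⟩), (![-1,0,0,1], ⟨(0, 1), lt01⟩), (![-1,0,0,0], ⟨(0, 3), lt03⟩), (![-1,1,0,0], ⟨(0, 3), lt03⟩), (![0,0,0,1], ⟨(0, 1), lt01⟩), (![0,0,0,0], ⟨(0, 3), lt03⟩), (![0,1,0,0], ⟨(0, 3), lt03⟩)} : Finset (ZdPlaquette 4)),
        ({(![-1,0,0,0], ⟨(0, 2), lt02⟩), (![0,0,0,0], ⟨(0, 2), lt02⟩), (![-1,0,0,0], ⟨(2, 3), lt23⟩), (![1,0,0,0], ⟨(2, 3), lt23⟩), (![-1,0,0,1], ⟨(0, 2), lt02⟩), (![-1,0,0,0], ⟨(0, 3), lt03⟩), (![-1,0,1,0], ⟨(0, 3), lt03⟩), (![0,0,0,1], ⟨(0, 2), lt02⟩), (![0,0,0,0], ⟨(0, 3), lt03⟩), (![0,0,1,0], ⟨(0, 3), lt03⟩)} : Finset (ZdPlaquette 4))} : Finset (Finset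 (ZdPlaquette 4))) := by
  decide

/-- **The tube classification for the time-mirror pair** (the hypothesis `hclass` of
`…StrongCouplingMirrorJet.torusCov_mirror_floor_su2_single`, positively phrased): a closed family
`{(e₀; a), (-e₀; b)} ∪ Q`, `#Q ≤ 8`, of plaquettes of `ℤ⁴` is one of the three ten-face tubes
`T_{ab} = ∂([-1,1]₀ × [0,1]_a × [0,1]_b)`, `(a, b) = (1,2), (1,3), (2,3)` (listed literally as in `…MirrorTubes`). [folklore] -/
theorem mem_tubes_of_closed (a b : {q : Fin 4 × Fin 4 // q.1 < q.2}) (Q : Finset (ZdPlaquette 4)) (hQ : Q.card ≤ 8)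
    (hN : ∀ p ∈ insert ((((![1, 0, 0, 0] : Fin 4 → ℤ), a) : ZdPlaquette 4))
        (insert ((((![-1, 0, 0, 0] : Fin 4 → ℤ), b) : ZdPlaquette 4)) Q),
      ∀ ℓ ∈ plaquetteEdges p, ∃ p' ∈ insert ((((![1, 0, 0, 0] : Fin 4 → ℤ), a) : ZdPlaquette 4))
        (insert ((((![-1, 0, 0, 0] : Fin 4 → ℤ), b) : ZdPlaquette 4)) Q), p' ≠ p ∧ ℓ ∈ plaquetteEdges p') :
    insert ((((![1, 0, 0, 0] : Fin 4 → ℤ), a) : ZdPlaquette 4))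
        (insert ((((![-1, 0, 0, 0] : Fin 4 → ℤ), b) : ZdPlaquette 4)) Q) ∈
      ({({(![-1,0,0,0], ⟨(0, 1), lt01⟩), (![0,0,0,0], ⟨(0, 1), lt01⟩), (![-1,0,0,0], ⟨(1, 2), lt12⟩), (![1,0,0,0], ⟨(1, 2), lt12⟩), (![-1,0,1,0], ⟨(0, 1), lt01⟩), (![-1,0,0,0], ⟨(0, 2), lt02⟩), (![-1,1,0,0], ⟨(0, 2), lt02⟩), (![0,0,1,0], ⟨(0, 1), lt01⟩), (![0,0,0,0], ⟨(0, 2), lt02⟩), (![0,1,0,0], ⟨(0, 2), lt02⟩)} : Finset (ZdPlaquette 4)),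
        ({(![-1,0,0,0], ⟨(0, 1), lt01⟩), (![0,0,0,0], ⟨(0, 1), lt01⟩), (![-1,0,0,0], ⟨(1, 3), lt13⟩), (![1,0,0,0], ⟨(1, 3), lt13⟩), (![-1,0,0,1], ⟨(0, 1), lt01⟩), (![-1,0,0,0], ⟨(0, 3), lt03⟩), (![-1,1,0,0], ⟨(0, 3), lt03⟩), (![0,0,0,1], ⟨(0, 1), lt01⟩), (![0,0,0,0], ⟨(0, 3), lt03⟩), (![0,1,0,0], ⟨(0, 3), lt03⟩)} : Finset (ZdPlaquette 4)),
        ({(![-1,0,0,0], ⟨(0, 2), lt02⟩), (![0,0,0,0], ⟨(0, 2), lt02⟩), (![-1,0,0,0], ⟨(2, 3), lt23⟩), (![1,0,0,0], ⟨(2, 3), lt23⟩), (![-1,0,0,1], ⟨(0, 2), lt02⟩), (![-1,0,0,0], ⟨(0, 3), lt03⟩), (![-1,0,1,0], ⟨(0, 3), lt03⟩), (![0,0,0,1], ⟨(0, 2), lt02⟩), (![0,0,0,0], ⟨(0, 3), lt03⟩), (![0,0,1,0], ⟨(0, 3), lt03⟩)} : Finset (ZdPlaquette 4))} : Finset (Finset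 (ZdPlaquette 4))) := by
  have h10 : (insert ((((![1, 0, 0, 0] : Fin 4 → ℤ), a) : ZdPlaquette 4))
      (insert ((((![-1, 0, 0, 0] : Fin 4 → ℤ), b) : ZdPlaquette 4)) Q)).card ≤ 10 :=
    (card_insert_le _ _).trans (Nat.succ_le_succ ((card_insert_le _ _).trans (Nat.succ_le_succ hQ)))
  obtain ⟨ha, hF⟩ := eq_tube_of_closed hN h10 (mem_insert_self _ _)
    ⟨(((![-1, 0, 0, 0] : Fin 4 → ℤ), b) : ZdPlaquette 4), mem_insert_of_mem (mem_insert_self _ _),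
      by show ((![-1, 0, 0, 0] : Fin 4 → ℤ) 0) = (![1, 0, 0, 0] : Fin 4 → ℤ) 0 - 2; decide⟩
  rw [hF]
  exact tube_mem_tubes a ha

end Summit.QuantumFields.YangMills.Cruxes.NT.StrongCouplingRung.ClosedFamilies
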